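import Literature.Computability.AlgebraicComplexity.DDS21PhiGradingBridge
import Literature.Computability.AlgebraicComplexity.DDS21GradedFractions
import Literature.Computability.AlgebraicComplexity.DDS21TraceBackStep
import HarnessLib

/-!
# DDS21 Thm. 3.2 final assembly, sibling file: dilation of graded-frame data into the `z`-frame
# (§1: the `z`-shifted dilation `dil_m g` — algebra and programs)

Theorem-only file (cell `val-lit`, np lane, RULING (142)(a): the per-round instantiation of the
trace-back transcript from the graded `x`-frame residues). Source: P. Dutta, P. Dwivedi,
N. Saxena, *Demystifying the border of depth-3 algebraic circuits*, FOCS 2021, full version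
`paper:galaxy-pdf-7641649743695546420`, §3 proof of Thm. 3.2: the map `Φ : x_i ↦ z·x_i + α_i`
(p0028 L751–757), the normalisation "`T =: z^{v}·T̃`", "`d_{j+1} = d_j − v − 1`" (p0030 L808,
p0031 L815), "`(T/z^v)|_{z=0}`" (p0030 L804–805) [DuttaDwivediSaxena2022].

Frame decision of record: (α′), RULING (144)(a) (t24 g13 decider): the ∂-form trace-back field
list AS LANDED (`DDS21TraceBackAssembly.lean`), fed with `ldeg`-SHIFTED dilations of the divisor
representatives and of the top residue pair, virtual `N, E` by the trace-back recursion, and ONE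
link lemma `g_j = z^{[j ≥ 1]} · N_j / E_j` (v2 of this file).

## Contents (v1)

* §1 the `z`-SHIFTED DILATION: for `g ∈ F[x_1..x_n]` and `m`, the dilation `g(z·x) = ∑_c z^c·g_c`
  (t18's bridge `dilate_eq_sum`; `z = x_0`) is `z^m · ∑_{c ≤ deg g} z^c · rename succ (g_{m+c})`
  as soon as the components `g_c`, `c < m`, vanish (e.g. `m ≤ ldeg g`, B4a); the quotient's
  `z = 0` slice is `g_m` — at `m = ldeg g` the INITIAL FORM of `g`, nonzero — which is what the
  trace-back step inverts ("`T =: z^v · T̃`", "`(T/z^v)|_{z=0}`", `v = 0` after normalisation);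
  programs of size `s^7` from a program of size `s` for `g` (`UABPComputes.dilShift`, toolkit
  `homogeneousComponent / rename / sum`). Decls: `dilate_eq_sum_range_of_lt`,
  `dilate_eq_X_pow_mul_dilShift(_of_le_ldeg)`, `coeff_dilShift`, `truncDegreeOf_one_dilShift(_ldeg)`,
  `rename_succ_initialForm_ne_zero`, `UABPComputes.dilShift`.
* `z`-units are coprime to `z`: `truncDegreeOf_eq_zero_of_mul_zunit` (`P·E ≡ 0 (mod z^m)`,
  `E|_{z=0}` nonzero `z`-free ⇒ `P ≡ 0 (mod z^m)`, via t24's truncated inverse).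
* §3 the TOP SEAM (`HOME/np/NOTE-p1g10-Thm32-assembly-top.md` §3, (α′)(4)): from the last residue
  `f_r = N₀/D₀` with programs and the dilated cross identity `z^v · N_r · dil(D₀) = dil(N₀) · E_r`
  (`E_r` a `z`-unit), the components of `N₀` below `ldeg D₀ + v` vanish
  (`homogeneousComponent_eq_zero_of_cross`) and ★ `exists_top_pair` delivers `At, Bt` with the
  EXACT identity `N_r · Bt = At · E_r`, `Bt|_{z=0} = rename succ (in D₀) ≠ 0`, programs `≤ s^7` —
  the inputs `htop/hβt/hβt0/hAtP/hBtP/hβtP` of `uabpComputes_of_traceBackTranscript(_lin)`.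
* v2 (to follow): §2 dilation on fraction fields, its intertwining of the Euler derivation of
  `F(x)` with `z∂_z` on `F(z,x)`, and the link lemma (α′)(3).

0 definitions (the shifted dilation is spelled inline), 0 named facts. Honest framing: plumbing;
`DDS2021_thm_3_2` OPEN by name; VP ≠ VNP NOT proved.

## References

* [DuttaDwivediSaxena2022] P. Dutta, P. Dwivedi, N. Saxena, *Demystifying the border of depth-3
  algebraic circuits*, Proc. 62nd FOCS (2021), IEEE 2022, 92–103; full version §3 (p0028
  L751–757, p0030 L804–812, p0031 L815).
-/

noncomputable section

open MvPolynomial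
open Literature.RingTheory.MvPolynomial
open scoped BigOperators

namespace Literature.Computability.AlgebraicComplexity

namespace DDS2021

section DilShift

variable {R : Type*} [CommSemiring R] {n : ℕ}

/-- The graded dilation formula with any summation bound above the degree:
`g(z·x) = ∑_{k < N} z^k · rename succ (g_k)` for `deg g < N`.
[cite: DuttaDwivediSaxena2022, §3 proof of Thm. 3.2, "`Φ : x_i ↦ z·x_i + α_i`" (full version p0028 L751–757)] -/
theorem dilate_eq_sum_range_of_lt (g : MvPolynomial (Fin n) R) {N : ℕ} (hN : g.totalDegree < N) :
    bind₁ (fun i : Fin n => (X 0 * X i.succ : MvPolynomial (Fin (n + 1)) R)) g =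
      ∑ k ∈ Finset.range N,
        (X 0 : MvPolynomial (Fin (n + 1)) R) ^ k * rename Fin.succ (homogeneousComponent k g) := by
  rw [dilate_eq_sum]
  refine Finset.sum_subset (Finset.range_subset_range.2 hN) fun k hk hk' => ?_
  rw [Finset.mem_range] at hk hk'
  rw [homogeneousComponent_eq_zero _ _ (by omega), map_zero, mul_zero]

/-- **The `z`-shifted dilation**: if the homogeneous components of `g` below `m` vanish then
`g(z·x) = z^m · ∑_{c ≤ deg g} z^c · rename succ (g_{m+c})` ("`T =: z^{v}·T̃`").
[cite: DuttaDwivediSaxena2022, §3 proof of Thm. 3.2 (full version p0030 L808, p0031 L815)] -/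
theorem dilate_eq_X_pow_mul_dilShift (g : MvPolynomial (Fin n) R) {m : ℕ}
    (hm : ∀ c < m, homogeneousComponent c g = 0) :
    bind₁ (fun i : Fin n => (X 0 * X i.succ : MvPolynomial (Fin (n + 1)) R)) g =
      (X 0 : MvPolynomial (Fin (n + 1)) R) ^ m *
        ∑ c ∈ Finset.range (g.totalDegree + 1),
          (X 0 : MvPolynomial (Fin (n + 1)) R) ^ c *
            rename Fin.succ (homogeneousComponent (m + c) g) := by
  rw [dilate_eq_sum_range_of_lt g (N := m + (g.totalDegree + 1)) (by omega),
    Finset.sum_range_add, Finset.sum_eq_zero fun k hk => by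
      rw [hm k (Finset.mem_range.1 hk), map_zero, mul_zero],
    zero_add, Finset.mul_sum]
  refine Finset.sum_congr rfl fun c _ => ?_
  rw [pow_add, mul_assoc]

/-- The hypothesis of `dilate_eq_X_pow_mul_dilShift` from the lowest degree: the components below
`ldeg g` vanish. [cite: DuttaDwivediSaxena2022, §3 proof of Thm. 3.2 (full version p0030 L804–808)] -/
theorem dilate_eq_X_pow_mul_dilShift_of_le_ldeg {K : Type*} [Field K] (g : MvPolynomial (Fin n) K)
    {m : ℕ} (hm : m ≤ ldeg g) :
    bind₁ (fun i : Fin n => (X 0 * X i.succ : MvPolynomial (Fin (n + 1)) K)) g =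
      (X 0 : MvPolynomial (Fin (n + 1)) K) ^ m *
        ∑ c ∈ Finset.range (g.totalDegree + 1),
          (X 0 : MvPolynomial (Fin (n + 1)) K) ^ c *
            rename Fin.succ (homogeneousComponent (m + c) g) :=
  dilate_eq_X_pow_mul_dilShift g fun _ hc =>
    homogeneousComponent_eq_zero_of_lt_ldeg (lt_of_lt_of_le hc hm)

/-- Coefficients of the shifted dilation: the monomial `z^{c} · x^{e}` carries
`coeff e (g_{m+c})`. [cite: DuttaDwivediSaxena2022, §3 proof of Thm. 3.2 (full version p0028 L751–757)] -/
theorem coeff_dilShift (g : MvPolynomial (Fin n) R) (m : ℕ) (d : Fin (n + 1) →₀ ℕ) :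
    coeff d (∑ c ∈ Finset.range (g.totalDegree + 1),
        (X 0 : MvPolynomial (Fin (n + 1)) R) ^ c * rename Fin.succ (homogeneousComponent (m + c) g)) =
      coeff (Finsupp.tail d) (homogeneousComponent (m + d 0) g) := by
  classical
  rw [coeff_sum]
  simp_rw [coeff_X_pow_mul_rename_succ]
  rw [Finset.sum_ite_eq]
  split_ifs with h
  · rfl
  · rw [Finset.mem_range, not_lt] at h
    rw [homogeneousComponent_eq_zero _ _ (by omega), coeff_zero]

/-- **The `z = 0` slice of the shifted dilation is the degree-`m` component**:
`(∑_c z^c · rename succ (g_{m+c}))|_{z=0} = rename succ (g_m)` ("`(T/z^v)|_{z=0}`"; at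
`m = ldeg g` this is the initial form of `g`, nonzero).
[cite: DuttaDwivediSaxena2022, §3 proof of Thm. 3.2, induction hypothesis (3) (full version p0030 L804–805)] -/
theorem truncDegreeOf_one_dilShift (g : MvPolynomial (Fin n) R) (m : ℕ) :
    truncDegreeOf 0 1 (∑ c ∈ Finset.range (g.totalDegree + 1),
        (X 0 : MvPolynomial (Fin (n + 1)) R) ^ c * rename Fin.succ (homogeneousComponent (m + c) g)) =
      rename Fin.succ (homogeneousComponent m g) := by
  classical
  ext d
  rw [coeff_truncDegreeOf, coeff_dilShift]
  have h1 := coeff_X_pow_mul_rename_succ 0 (homogeneousComponent m g) d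
  rw [pow_zero, one_mul] at h1
  rw [h1]
  by_cases hd : d 0 = 0
  · rw [if_pos (by omega), if_pos hd, hd, add_zero]
  · rw [if_neg (by omega), if_neg hd]

/-- At `m = ldeg g` the slice is the (renamed) initial form, nonzero for `g ≠ 0`.
[cite: DuttaDwivediSaxena2022, §3 proof of Thm. 3.2, induction hypothesis (3) (full version p0030 L804–805)] -/
theorem truncDegreeOf_one_dilShift_ldeg {K : Type*} [Field K] (g : MvPolynomial (Fin n) K) :
    truncDegreeOf 0 1 (∑ c ∈ Finset.range (g.totalDegree + 1),
        (X 0 : MvPolynomial (Fin (n + 1)) K) ^ c *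
          rename Fin.succ (homogeneousComponent (ldeg g + c) g)) =
      rename Fin.succ (initialForm g) :=
  truncDegreeOf_one_dilShift g (ldeg g)

/-- The renamed initial form is nonzero. [cite: DuttaDwivediSaxena2022, §3 proof of Thm. 3.2, induction hypothesis (3) (full version p0030 L804–805)] -/
theorem rename_succ_initialForm_ne_zero {K : Type*} [Field K] {g : MvPolynomial (Fin n) K}
    (hg : g ≠ 0) : rename Fin.succ (initialForm g) ≠ (0 : MvPolynomial (Fin (n + 1)) K) := fun h =>
  initialForm_ne_zero hg (rename_injective _ (Fin.succ_injective n) (by rw [h, map_zero]))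

end DilShift

/-! ### `z`-units are coprime to `z`: cancelling a unit factor from `z^m ∣ P·E`

For the TOP seam (NOTE-p1g10 §3): from the dilated cross identity `N_r · z^m · Bt = dil(N₀) · E_r`
with `E_r` a `z`-unit one gets `z^m ∣ dil(N₀)`, i.e. `ldeg N₀ ≥ m`, so that the shifted dilation
of the numerator is available too. -/

section ZUnit

variable {S : Type*} [CommRing S] [IsDomain S] {σ : Type*} [DecidableEq σ]

/-- **Cancelling a `z`-unit modulo `z^m`**: if `P · E ≡ 0 (mod z^m)` and `E|_{z=0} = b` is a
NONZERO `z`-free polynomial, then `P ≡ 0 (mod z^m)` (multiply by the truncated inverse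
`Inv_{m−1}` of `E`: `E · Inv ≡ b^m`, then cancel the `z`-free factor `b^m`).
[cite: DuttaDwivediSaxena2022, §3 proof of Thm. 3.2, Claim 3.7 (full version p0034 L906–913) and Lemma 2.6 (p0018 L493–495)] -/
theorem truncDegreeOf_eq_zero_of_mul_zunit {i : σ} {P E b : MvPolynomial σ S} {m : ℕ}
    (hb : truncDegreeOf i 1 E = b) (hb0 : b ≠ 0) (h : truncDegreeOf i m (P * E) = 0) :
    truncDegreeOf i m P = 0 := by
  cases m with
  | zero => exact truncDegreeOf_zero_right i P
  | succ M =>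
    have hbz : b.degreeOf i = 0 := by rw [← hb]; exact degreeOf_truncDegreeOf_one i E
    have hbMz : (b ^ (M + 1)).degreeOf i = 0 := by
      have h := degreeOf_pow_le i b (M + 1)
      rw [hbz, mul_zero] at h
      exact Nat.le_zero.1 h
    set Inv : MvPolynomial σ S := ∑ j ∈ Finset.range (M + 1), b ^ j * (b - E) ^ (M - j) with hInv
    -- `T (P · (E · Inv)) = T (P · b^{M+1}) = b^{M+1} · T P`
    have h1 : truncDegreeOf i (M + 1) (P * (E * Inv)) = b ^ (M + 1) * truncDegreeOf i (M + 1) P := by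
      rw [truncDegreeOf_mul_congr (p := P) (p' := P) rfl (truncDegreeOf_mul_truncInv hb M),
        mul_comm P, truncDegreeOf_mul_of_degreeOf_eq_zero hbMz]
    -- `T (P · E · Inv) = T (0 · Inv) = 0`
    have h2 : truncDegreeOf i (M + 1) (P * (E * Inv)) = 0 := by
      have h0 : truncDegreeOf i (M + 1) (P * E) = truncDegreeOf i (M + 1) 0 := by
        rw [h, map_zero]
      rw [← mul_assoc, truncDegreeOf_mul_congr h0 (rfl : truncDegreeOf i (M + 1) Inv = _), zero_mul,
        map_zero]
    rw [h2] at h1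
    exact (mul_eq_zero.1 h1.symm).resolve_left (pow_ne_zero _ hb0)

end ZUnit

/-! ### Programs for the shifted dilation -/

section Programs

variable {F : Type*} [Field F] {n : ℕ}

/-- Crude power bookkeeping: `a ≤ s^i`, `b ≤ s^i`, `2 ≤ s` ⇒ `a + b ≤ s^{i+1}`. [cite: DuttaDwivediSaxena2022, §3 "Size blowup" (full version p0036 L952–958)] -/
private theorem qadd {s i a b : ℕ} (hs : 2 ≤ s) (ha : a ≤ s ^ i) (hb : b ≤ s ^ i) :
    a + b ≤ s ^ (i + 1) := by
  rw [pow_succ]; nlinarith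

/-- `a ≤ s^i`, `b ≤ s^j` ⇒ `a·b ≤ s^{i+j}`. [cite: DuttaDwivediSaxena2022, §3 "Size blowup" (full version p0036 L952–958)] -/
private theorem qmul {s i j a b : ℕ} (ha : a ≤ s ^ i) (hb : b ≤ s ^ j) : a * b ≤ s ^ (i + j) := by
  rw [pow_add]; exact Nat.mul_le_mul ha hb

/-- Monotonicity in the exponent. [cite: DuttaDwivediSaxena2022, §3 "Size blowup" (full version p0036 L952–958)] -/
private theorem qmono {s i j a : ℕ} (hs : 2 ≤ s) (hij : i ≤ j) (ha : a ≤ s ^ i) : a ≤ s ^ j :=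
  ha.trans (Nat.pow_le_pow_right (by omega) hij)

/-- Arithmetic: `s + s·(2s+1) ≤ s^4` for `s ≥ 2`. [cite: DuttaDwivediSaxena2022, §3 "Size blowup" (full version p0036 L952–958)] -/
private theorem term_budget_le {s : ℕ} (hs : 2 ≤ s) : s + s * (2 * s + 1) ≤ s ^ 4 := by
  have h4 : 4 ≤ s * s := Nat.mul_le_mul hs hs
  have e : s ^ 4 = s * s * (s * s) := by ring
  rw [e]
  nlinarith

/-- Arithmetic: `(s+1)·(s^4 + s^4) + 2 ≤ s^7` for `s ≥ 2`. [cite: DuttaDwivediSaxena2022, §3 "Size blowup" (full version p0036 L952–958)] -/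
private theorem sum_budget_le {s : ℕ} (hs : 2 ≤ s) : (s + 1) * (s ^ 4 + s ^ 4) + 2 ≤ s ^ 7 := by
  have h4 : 4 ≤ s * s := Nat.mul_le_mul hs hs
  have e7 : s ^ 7 = s ^ 4 * s * (s * s) := by ring
  have e5 : (s + 1) * (s ^ 4 + s ^ 4) + 2 = 2 * (s ^ 4 * s) + 2 * s ^ 4 + 2 := by ring
  rw [e7, e5]
  have hs4 : 16 ≤ s ^ 4 := by
    calc 16 = 2 ^ 4 := by norm_num
      _ ≤ s ^ 4 := Nat.pow_le_pow_left hs 4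
  have ha : 2 * s ^ 4 ≤ s ^ 4 * s := by nlinarith
  have hb : 2 ≤ s ^ 4 * s := by nlinarith
  have hc : 2 * (s ^ 4 * s) + 2 * s ^ 4 + 2 ≤ 4 * (s ^ 4 * s) := by omega
  exact hc.trans (by nlinarith)

/-- **Programs for the shifted dilation**: from a program for `g` within `s`, `deg g ≤ s`,
`m ≤ s`, `2 ≤ s`, the polynomial `∑_{c ≤ deg g} z^c · rename succ (g_{m+c})` has a program within
`s^7` (graded copies `g_{m+c}` within `s·(2s+1)`, one label edge `z^c`, product, sum of `deg g + 1`
terms). [cite: DuttaDwivediSaxena2022, §3 proof of Thm. 3.2, "Size blowup" (full version p0036 L952–958)] -/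
theorem UABPComputes.dilShift {s m : ℕ} {g : MvPolynomial (Fin n) F} (hg : UABPComputes s g)
    (hdeg : g.totalDegree ≤ s) (hm : m ≤ s) (hs : 2 ≤ s) :
    UABPComputes (s ^ 7) (∑ c ∈ Finset.range (g.totalDegree + 1),
      (X 0 : MvPolynomial (Fin (n + 1)) F) ^ c *
        MvPolynomial.rename Fin.succ (MvPolynomial.homogeneousComponent (m + c) g)) := by
  classical
  -- each term within `s^4`
  have hterm : ∀ c : Fin (g.totalDegree + 1), UABPComputes (s ^ 4)
      ((X 0 : MvPolynomial (Fin (n + 1)) F) ^ (c : ℕ) *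
        MvPolynomial.rename Fin.succ (MvPolynomial.homogeneousComponent (m + c) g)) := by
    intro c
    have hc : (c : ℕ) ≤ s := (Nat.le_of_lt_succ c.isLt).trans hdeg
    have hX : UABPComputes s ((X 0 : MvPolynomial (Fin (n + 1)) F) ^ (c : ℕ)) := by
      refine (UABPComputesLen.of_label hs _ ?_ ?_).uabpComputes
      · refine (Finset.card_le_card (vars_pow _ _)).trans ?_
        rw [vars_X, Finset.card_singleton]
      · refine (totalDegree_pow _ _).trans ?_
        rw [totalDegree_X, mul_one]
        exact hc
    have hH : UABPComputes (s * (2 * s + 1))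
        (MvPolynomial.rename Fin.succ (MvPolynomial.homogeneousComponent (m + c) g) :
          MvPolynomial (Fin (n + 1)) F) :=
      (hg.homogeneousComponent (D := 2 * s) (k := m + c) (by omega)).rename Fin.succ
    exact (hX.mul hH).mono (term_budget_le hs)
  have hsum := UABPComputes.sum (show 2 ≤ s ^ 4 from
      hs.trans (Nat.le_self_pow (by norm_num) s)) _ hterm
  rw [Fintype.card_fin] at hsum
  rw [Finset.sum_range]
  refine hsum.mono (le_trans ?_ (sum_budget_le hs))
  have hd1 : g.totalDegree + 1 ≤ s + 1 := by omega
  exact Nat.add_le_add_right (Nat.mul_le_mul_right _ hd1) 2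

end Programs

/-! ## §3 The TOP seam: from the last residue `f_r = N₀/D₀` to the pair `(At, Bt)` with `Bt|_{z=0} ≠ 0`

NOTE-p1g10-Thm32-assembly-top.md §3: `βt := in(D₀)`, `Bt := dil_{ldeg D₀} D₀`, `At := dil_{ldeg D₀} N₀`
(the numerator IS divisible by `z^{ldeg D₀}` because `E_r` is a `z`-unit), giving the EXACT
identity `N_r · Bt = At · E_r` — hence the trace-back's top congruence at every precision — and
programs of size `s^7` from programs of size `s` for `N₀, D₀`. -/

section Top

variable {F : Type*} [Field F] {n : ℕ}

/-- Vanishing of the low homogeneous components from a dilated identity with a `z`-unit: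
if `z^v · N_r · dil(D₀) = dil(N₀) · E_r`, `E_r|_{z=0} ≠ 0` (`z`-free), then every homogeneous
component of `N₀` of degree `< ldeg D₀ + v` vanishes.
[cite: DuttaDwivediSaxena2022, §3 proof of Thm. 3.2, Claim 3.7 "`e₁ ≥ e₂`" (full version p0034 L906–909)] -/
theorem homogeneousComponent_eq_zero_of_cross {N₀ D₀ : MvPolynomial (Fin n) F}
    {Nr Er b : MvPolynomial (Fin (n + 1)) F} {v : ℕ} (hb : truncDegreeOf 0 1 Er = b) (hb0 : b ≠ 0)
    (hcross : (X 0 : MvPolynomial (Fin (n + 1)) F) ^ v * Nr *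
        bind₁ (fun i : Fin n => (X 0 * X i.succ : MvPolynomial (Fin (n + 1)) F)) D₀ =
      bind₁ (fun i : Fin n => (X 0 * X i.succ : MvPolynomial (Fin (n + 1)) F)) N₀ * Er) :
    ∀ c < ldeg D₀ + v, homogeneousComponent c N₀ = 0 := by
  classical
  set m := ldeg D₀ with hm
  -- `dil N₀ · E_r = z^{m+v} · (N_r · Bt)` is `≡ 0 (mod z^{m+v})`
  have hdiv : truncDegreeOf 0 (m + v)
      (bind₁ (fun i : Fin n => (X 0 * X i.succ : MvPolynomial (Fin (n + 1)) F)) N₀ * Er) = 0 := by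
    rw [← hcross, dilate_eq_X_pow_mul_dilShift_of_le_ldeg D₀ (le_refl m)]
    set S := ∑ c ∈ Finset.range (D₀.totalDegree + 1), (X 0 : MvPolynomial (Fin (n + 1)) F) ^ c *
      rename Fin.succ (homogeneousComponent (m + c) D₀) with hS
    rw [show (X 0 : MvPolynomial (Fin (n + 1)) F) ^ v * Nr * ((X 0 : MvPolynomial (Fin (n + 1)) F) ^ m * S)
        = (X 0 : MvPolynomial (Fin (n + 1)) F) ^ (m + v) * (Nr * S) from by ring]
    have h := truncDegreeOf_X_pow_mul (R := F) (0 : Fin (n + 1)) 0 (m + v) (Nr * S)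
    rw [zero_add, truncDegreeOf_zero_right, mul_zero] at h
    exact h
  have hT : truncDegreeOf 0 (m + v)
      (bind₁ (fun i : Fin n => (X 0 * X i.succ : MvPolynomial (Fin (n + 1)) F)) N₀) = 0 :=
    truncDegreeOf_eq_zero_of_mul_zunit hb hb0 hdiv
  -- read off the components below `m + v`
  intro c hc
  ext e
  rw [coeff_zero]
  have hdil := dilate_eq_X_pow_mul_dilShift N₀ (m := 0) (fun c hc => absurd hc (Nat.not_lt_zero c))
  rw [pow_zero, one_mul] at hdil
  have h1 := congr_arg (coeff (Finsupp.cons c e)) hT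
  rw [coeff_truncDegreeOf, Finsupp.cons_zero, if_pos hc, hdil, coeff_dilShift, Finsupp.tail_cons,
    Finsupp.cons_zero, zero_add, coeff_zero] at h1
  exact h1

/-- **The TOP pair.** From the last residue `f_r = N₀/D₀` (`D₀ ≠ 0`, programs within `s`,
degrees `≤ s`, `2 ≤ s`) and the dilated cross identity `z^v · N_r · dil(D₀) = dil(N₀) · E_r`
(`v = [r ≥ 1]` under the seam decision (α′), RULING (144)(a)) with `E_r` a `z`-unit
(`E_r|_{z=0} = b ≠ 0`): the `z`-shifted dilations `Bt := dil_{m} D₀`, `At := dil_{m+v} N₀`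
(`m = ldeg D₀`) satisfy the EXACT identity `N_r · Bt = At · E_r`, `Bt|_{z=0} = rename succ (in D₀)`
(nonzero), with programs within `s^7` (`v ≤ s` assumed) — the inputs `htop / hβt / hβt0 / hAtP /
hBtP / hβtP` of the trace-back assembly ("`f_{k−1}` has a `poly`-size ABP/ABP … `e₁ ≥ e₂`").
[cite: DuttaDwivediSaxena2022, §3 proof of Thm. 3.2, Claim 3.7 (full version p0034 L904–913)] -/
theorem exists_top_pair {s v : ℕ} {N₀ D₀ : MvPolynomial (Fin n) F}
    {Nr Er b : MvPolynomial (Fin (n + 1)) F}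
    (hD₀ : D₀ ≠ 0) (hb : truncDegreeOf 0 1 Er = b) (hb0 : b ≠ 0)
    (hcross : (X 0 : MvPolynomial (Fin (n + 1)) F) ^ v * Nr *
        bind₁ (fun i : Fin n => (X 0 * X i.succ : MvPolynomial (Fin (n + 1)) F)) D₀ =
      bind₁ (fun i : Fin n => (X 0 * X i.succ : MvPolynomial (Fin (n + 1)) F)) N₀ * Er)
    (hN₀P : UABPComputes s N₀) (hD₀P : UABPComputes s D₀) (hdN : N₀.totalDegree ≤ s)
    (hdD : D₀.totalDegree ≤ s) (hv : ldeg D₀ + v ≤ s) (hs : 2 ≤ s) :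
    ∃ At Bt : MvPolynomial (Fin (n + 1)) F,
      Nr * Bt = At * Er ∧ truncDegreeOf 0 1 Bt = rename Fin.succ (initialForm D₀) ∧
        rename Fin.succ (initialForm D₀) ≠ (0 : MvPolynomial (Fin (n + 1)) F) ∧
        UABPComputes (s ^ 7) At ∧ UABPComputes (s ^ 7) Bt ∧
        UABPComputes (s ^ 7) (initialForm D₀) := by
  classical
  set m := ldeg D₀ with hm
  have hmd : m ≤ D₀.totalDegree := ldeg_le_totalDegree D₀
  set Bt : MvPolynomial (Fin (n + 1)) F := ∑ c ∈ Finset.range (D₀.totalDegree + 1),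
    (X 0 : MvPolynomial (Fin (n + 1)) F) ^ c * rename Fin.succ (homogeneousComponent (m + c) D₀)
    with hBt
  set At : MvPolynomial (Fin (n + 1)) F := ∑ c ∈ Finset.range (N₀.totalDegree + 1),
    (X 0 : MvPolynomial (Fin (n + 1)) F) ^ c * rename Fin.succ (homogeneousComponent (m + v + c) N₀)
    with hAt
  have hdD' := dilate_eq_X_pow_mul_dilShift_of_le_ldeg D₀ (le_refl m)
  have hdN' := dilate_eq_X_pow_mul_dilShift N₀ (m := m + v)
    (homogeneousComponent_eq_zero_of_cross hb hb0 hcross)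
  refine ⟨At, Bt, ?_, truncDegreeOf_one_dilShift_ldeg D₀, rename_succ_initialForm_ne_zero hD₀,
    hN₀P.dilShift hdN hv hs, hD₀P.dilShift hdD (hmd.trans hdD) hs, ?_⟩
  · -- cancel `z^{m+v}` from `z^{m+v} (N_r Bt) = z^{m+v} (At E_r)`
    have h : (X 0 : MvPolynomial (Fin (n + 1)) F) ^ (m + v) * (Nr * Bt) =
        (X 0 : MvPolynomial (Fin (n + 1)) F) ^ (m + v) * (At * Er) := by
      calc (X 0 : MvPolynomial (Fin (n + 1)) F) ^ (m + v) * (Nr * Bt)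
          = (X 0 : MvPolynomial (Fin (n + 1)) F) ^ v * Nr *
              ((X 0 : MvPolynomial (Fin (n + 1)) F) ^ m * Bt) := by ring
        _ = (X 0 : MvPolynomial (Fin (n + 1)) F) ^ (m + v) * At * Er := by rw [← hdD', hcross, hdN']
        _ = _ := by ring
    exact mul_left_cancel₀ (pow_ne_zero (m + v) (X_ne_zero (0 : Fin (n + 1)))) h
  · refine (hD₀P.homogeneousComponent (D := s) (k := m) (hmd.trans hdD)).mono ?_
    calc s * (s + 1) ≤ s ^ 4 := (term_budget_le hs).trans' (by nlinarith)
      _ ≤ s ^ 7 := Nat.pow_le_pow_right (by omega) (by norm_num)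

end Top

/-! ## §2 (v2) Dilation on fraction fields, `z∂_z`, and the link lemma of the seam decision (α′)

The graded-frame residues `f_j ∈ F(x)` (x5 g8's chain: `f_{j+1} = E(f_j/t_j)`, `E` = B4a's
`eulerFrac`) are pushed into the `z`-frame by the field map `dilFrac : F(x) → F(z,x)` induced by
the (injective) dilation `x_i ↦ z·x_{i+1}`; it intertwines `E` with the extension `zDerivFrac` of
`z∂_z` (bridge `X_zero_mul_pderiv_zero_dilate`). The LINK LEMMA ((α′)(3), RULING (144)(a)): with
the divisors fed as `ldeg`-shifted dilations `z^{a_j} A_j = dil(tn_j)`, `z^{b_j} B_j = dil(td_j)`,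
`a_j = b_j + [j ≥ 1]`, and `N, E` defined by the trace-back recursion,
`g_j · E_j = z^{[j ≥ 1]} · N_j` in `F(z,x)` for every `j ≤ r` (`[j ≥ 1] = min j 1`). -/

section FracDilation

variable {F : Type*} [Field F] {n : ℕ}

/-- Homogeneous components are determined by the dilation (its `z^k`-coefficients).
[cite: DuttaDwivediSaxena2022, §3 proof of Thm. 3.2 (full version p0028 L751–757)] -/
theorem homogeneousComponent_eq_of_dilate_eq {g h : MvPolynomial (Fin n) F}
    (hgh : bind₁ (fun i : Fin n => (X 0 * X i.succ : MvPolynomial (Fin (n + 1)) F)) g =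
      bind₁ (fun i : Fin n => (X 0 * X i.succ : MvPolynomial (Fin (n + 1)) F)) h) (k : ℕ) :
    homogeneousComponent k g = homogeneousComponent k h := by
  rw [← finSuccEquiv_dilate_coeff g k, ← finSuccEquiv_dilate_coeff h k, hgh]

/-- **The dilation `x_i ↦ z·x_{i+1}` is injective.**
[cite: DuttaDwivediSaxena2022, §3 proof of Thm. 3.2, "Φ … can be seen as a homomorphism" (full version p0028 L751–757)] -/
theorem dilate_injective :
    Function.Injective (bind₁ (fun i : Fin n => (X 0 * X i.succ : MvPolynomial (Fin (n + 1)) F))) := by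
  intro g h hgh
  ext d
  have hk := congr_arg (coeff d) (homogeneousComponent_eq_of_dilate_eq hgh d.degree)
  rwa [coeff_homogeneousComponent, coeff_homogeneousComponent, if_pos rfl, if_pos rfl] at hk

/-- The dilation followed by the embedding into `F(z,x)` is injective.
[cite: DuttaDwivediSaxena2022, §3 proof of Thm. 3.2 (full version p0028 L751–757)] -/
theorem algebraMap_comp_dilate_injective :
    Function.Injective ((algebraMap (MvPolynomial (Fin (n + 1)) F)
        (FractionRing (MvPolynomial (Fin (n + 1)) F))).comp
      (bind₁ (fun i : Fin n => (X 0 * X i.succ : MvPolynomial (Fin (n + 1)) F))).toRingHom) :=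
  (IsFractionRing.injective _ _).comp dilate_injective

variable (F n)

/-- **The dilation on fraction fields** `dilFrac : F(x) → F(z,x)`, `x_i ↦ z·x_{i+1}` (the field
map induced by the injective dilation; it carries the residues `f_j ∈ F(x)` of the graded frame to
the `z`-frame objects "`f_j ∈ F(x)[[z]]`" of the print, p0029 L777–779).
[cite: DuttaDwivediSaxena2022, §3 proof of Thm. 3.2, Claim 3.4 (full version p0029 L777–779)] -/
def dilFrac : FractionRing (MvPolynomial (Fin n) F) →+* FractionRing (MvPolynomial (Fin (n + 1)) F) :=
  IsFractionRing.lift (algebraMap_comp_dilate_injective (F := F) (n := n))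

/-- **`z∂_z` on `F[z,x]`** as a derivation (`z = x_0`). [cite: DuttaDwivediSaxena2022, §3 proof of Thm. 3.2, "Derive" (full version p0030 L811–812)] -/
def zDeriv : Derivation F (MvPolynomial (Fin (n + 1)) F) (MvPolynomial (Fin (n + 1)) F) :=
  (X 0 : MvPolynomial (Fin (n + 1)) F) • (pderiv 0 : Derivation F (MvPolynomial (Fin (n + 1)) F) _)

/-- **`z∂_z` on `F(z,x)`** (B4a's `locDeriv` of `zDeriv`). [cite: DuttaDwivediSaxena2022, §3 proof of Thm. 3.2, "Derive" (full version p0030 L811–812)] -/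
def zDerivFrac : Derivation F (FractionRing (MvPolynomial (Fin (n + 1)) F))
    (FractionRing (MvPolynomial (Fin (n + 1)) F)) :=
  locDeriv (zDeriv F n) (nonZeroDivisors (MvPolynomial (Fin (n + 1)) F))

variable {F n}

/-- `dilFrac` on polynomials is the dilation. [cite: DuttaDwivediSaxena2022, §3 proof of Thm. 3.2 (full version p0028 L751–757)] -/
@[simp] theorem dilFrac_algebraMap (p : MvPolynomial (Fin n) F) :
    dilFrac F n (algebraMap _ _ p) =
      algebraMap _ _ (bind₁ (fun i : Fin n => (X 0 * X i.succ : MvPolynomial (Fin (n + 1)) F)) p) :=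
  IsFractionRing.lift_algebraMap _ p

/-- `z∂_z` unfolds. [cite: DuttaDwivediSaxena2022, §3 proof of Thm. 3.2, "Derive" (full version p0030 L811–812)] -/
theorem zDeriv_apply (P : MvPolynomial (Fin (n + 1)) F) : zDeriv F n P = X 0 * pderiv 0 P := by
  rw [zDeriv, Derivation.smul_apply, smul_eq_mul]

/-- `z∂_z` on `F(z,x)` extends `z∂_z`. [cite: DuttaDwivediSaxena2022, §3 proof of Thm. 3.2, "Derive" (full version p0030 L811–812)] -/
@[simp] theorem zDerivFrac_algebraMap (P : MvPolynomial (Fin (n + 1)) F) :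
    zDerivFrac F n (algebraMap _ _ P) = algebraMap _ _ (X 0 * pderiv 0 P) := by
  rw [zDerivFrac, locDeriv_algebraMap, zDeriv_apply]

/-- Quotient rule for `z∂_z` on fractions of polynomials.
[cite: DuttaDwivediSaxena2022, §3 proof of Thm. 3.2, (3.1)–(3.2) (full version p0029 L766–767, p0030 L811–812)] -/
theorem zDerivFrac_div_algebraMap (P Q : MvPolynomial (Fin (n + 1)) F) :
    zDerivFrac F n (algebraMap _ (FractionRing (MvPolynomial (Fin (n + 1)) F)) P / algebraMap _ _ Q) =
      algebraMap _ _ (X 0 * (pderiv 0 P * Q - P * pderiv 0 Q)) / algebraMap _ _ Q ^ 2 := by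
  rw [(zDerivFrac F n).leibniz_div, zDerivFrac_algebraMap, zDerivFrac_algebraMap]
  simp only [smul_eq_mul, map_mul, map_sub, div_eq_mul_inv, inv_pow]
  ring

/-- **The dilation intertwines the Euler derivation of `F(x)` with `z∂_z` on `F(z,x)`**:
`dilFrac (E h) = z∂_z (dilFrac h)` (bridge `X_zero_mul_pderiv_zero_dilate`, quotient rules).
[cite: DuttaDwivediSaxena2022, §3 proof of Thm. 3.2 (full version p0030 L811–812, p0032 L858–871)] -/
theorem dilFrac_eulerFrac (h : FractionRing (MvPolynomial (Fin n) F)) :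
    dilFrac F n (eulerFrac (Fin n) F _ h) = zDerivFrac F n (dilFrac F n h) := by
  obtain ⟨p, q, hq, rfl⟩ := IsFractionRing.div_surjective (A := MvPolynomial (Fin n) F) h
  rw [eulerFrac_div_algebraMap, map_div₀, map_div₀, map_pow, dilFrac_algebraMap, dilFrac_algebraMap,
    dilFrac_algebraMap, zDerivFrac_div_algebraMap]
  congr 2
  rw [map_sub, map_mul, map_mul, euler_eq_sum_X_mul_pderiv, euler_eq_sum_X_mul_pderiv,
    ← X_zero_mul_pderiv_zero_dilate, ← X_zero_mul_pderiv_zero_dilate]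
  ring

end FracDilation

/-! ### The link lemma of (α′): `g_j · E_j = z^{[j ≥ 1]} · N_j` -/

section Link

variable {F : Type*} [Field F] {n : ℕ}

/-- **LINK LEMMA (seam decision (α′)(3), RULING (144)(a)).** Let the `z`-frame divisors be fed as
`ldeg`-shifted dilations `z^{a_j} A_j = dil(tn_j)`, `z^{b_j} B_j = dil(td_j)` with
`a_j = b_j + [j ≥ 1]` (`tn_j, td_j ≠ 0` — the graded valuation `1` of the divisors from stage `1`
on), let `N, E` obey the trace-back recursion (`E_0 = 1`,
`N_{j+1} = ∂(N_j B_j)·(E_j A_j) − N_j B_j·∂(E_j A_j)`, `E_{j+1} = (E_j A_j)²`), and let the chain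
`g` obey `g_0 = N_0`, `g_{j+1} = z∂_z(g_j / (dil tn_j / dil td_j))` in `F(z,x)`. Then for every
`j ≤ r`: `E_j ≠ 0` and `g_j · E_j = z^{min j 1} · N_j` — the Euler-frame chain and the print-frame
virtual fraction differ exactly by the factor `z` from round `1` on ("`d_{j+1} = d_j − v − 1`").
[cite: DuttaDwivediSaxena2022, §3 proof of Thm. 3.2, (3.1)–(3.2) and Claim 3.5 (full version p0029 L766–767, p0030 L808–812, p0031 L815–834)] -/
theorem link_of_recursion {r : ℕ} (tn td : ℕ → MvPolynomial (Fin n) F) (a b : ℕ → ℕ)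
    (A B N E : ℕ → MvPolynomial (Fin (n + 1)) F)
    (g : ℕ → FractionRing (MvPolynomial (Fin (n + 1)) F))
    (htn : ∀ j < r, tn j ≠ 0) (htd : ∀ j < r, td j ≠ 0)
    (hA : ∀ j < r, (X 0 : MvPolynomial (Fin (n + 1)) F) ^ a j * A j =
      bind₁ (fun i : Fin n => (X 0 * X i.succ : MvPolynomial (Fin (n + 1)) F)) (tn j))
    (hB : ∀ j < r, (X 0 : MvPolynomial (Fin (n + 1)) F) ^ b j * B j =
      bind₁ (fun i : Fin n => (X 0 * X i.succ : MvPolynomial (Fin (n + 1)) F)) (td j))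
    (hab : ∀ j < r, a j = b j + min j 1)
    (hE0 : E 0 = 1)
    (hNs : ∀ j < r, N (j + 1) = pderiv 0 (N j * B j) * (E j * A j) - N j * B j * pderiv 0 (E j * A j))
    (hEs : ∀ j < r, E (j + 1) = (E j * A j) ^ 2)
    (hg0 : g 0 = algebraMap _ _ (N 0))
    (hgs : ∀ j < r, g (j + 1) = zDerivFrac F n (g j /
      (algebraMap _ _ (bind₁ (fun i : Fin n => (X 0 * X i.succ : MvPolynomial (Fin (n + 1)) F)) (tn j)) /
        algebraMap _ _ (bind₁ (fun i : Fin n => (X 0 * X i.succ : MvPolynomial (Fin (n + 1)) F)) (td j))))) :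
    ∀ j ≤ r, E j ≠ 0 ∧
      g j * algebraMap _ _ (E j) = algebraMap _ _ ((X 0 : MvPolynomial (Fin (n + 1)) F) ^ min j 1 * N j) := by
  set ι := algebraMap (MvPolynomial (Fin (n + 1)) F) (FractionRing (MvPolynomial (Fin (n + 1)) F))
    with hι
  have hιinj : Function.Injective ι := IsFractionRing.injective _ _
  have hz : ι (X 0) ≠ 0 := fun h => X_ne_zero (0 : Fin (n + 1)) (hιinj (by rw [h, map_zero]))
  have hdil0 : ∀ p : MvPolynomial (Fin n) F, p ≠ 0 →
      bind₁ (fun i : Fin n => (X 0 * X i.succ : MvPolynomial (Fin (n + 1)) F)) p ≠ 0 := fun p hp h =>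
    hp (dilate_injective (by rw [h, map_zero]))
  intro j
  induction j with
  | zero =>
    intro _
    refine ⟨by rw [hE0]; exact one_ne_zero, ?_⟩
    rw [hg0, hE0, map_one, mul_one, Nat.zero_min, pow_zero, one_mul]
  | succ j ih =>
    intro hj
    have hjr : j < r := Nat.lt_of_succ_le hj
    obtain ⟨hEj, hgj⟩ := ih (by omega)
    -- `A j ≠ 0`, `B j ≠ 0`
    have hAj : A j ≠ 0 := fun h => hdil0 _ (htn j hjr) (by rw [← hA j hjr, h, mul_zero])
    have hBj : B j ≠ 0 := fun h => hdil0 _ (htd j hjr) (by rw [← hB j hjr, h, mul_zero])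
    refine ⟨by rw [hEs j hjr]; exact pow_ne_zero 2 (mul_ne_zero hEj hAj), ?_⟩
    -- the divisor quotient: `g_j / (dil tn / dil td) = (N_j B_j)/(E_j A_j)` (the `z`-powers cancel)
    have hquot : g j / (ι (bind₁ (fun i : Fin n => (X 0 * X i.succ : MvPolynomial (Fin (n + 1)) F)) (tn j)) /
        ι (bind₁ (fun i : Fin n => (X 0 * X i.succ : MvPolynomial (Fin (n + 1)) F)) (td j))) =
        ι (N j * B j) / ι (E j * A j) := by
      have hgj' : g j = ι ((X 0 : MvPolynomial (Fin (n + 1)) F) ^ min j 1 * N j) / ι (E j) := by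
        rw [eq_div_iff (fun h => hEj (hιinj (by rw [h, map_zero]))), hgj]
      rw [hgj', ← hA j hjr, ← hB j hjr, hab j hjr]
      have hEj' : ι (E j) ≠ 0 := fun h => hEj (hιinj (by rw [h, map_zero]))
      have hAj' : ι (A j) ≠ 0 := fun h => hAj (hιinj (by rw [h, map_zero]))
      have hBj' : ι (B j) ≠ 0 := fun h => hBj (hιinj (by rw [h, map_zero]))
      simp only [map_mul, map_pow]
      field_simp
      ring
    rw [hgs j hjr, hquot, zDerivFrac_div_algebraMap, hNs j hjr, hEs j hjr,
      show min (j + 1) 1 = 1 from Nat.min_eq_right (Nat.succ_le_succ (Nat.zero_le j)), pow_one,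
      map_pow]
    exact div_mul_cancel₀ _ (pow_ne_zero 2 fun h =>
      (mul_ne_zero hEj hAj) (hιinj (by rw [h, map_zero])))

/-- **The TOP cross identity from the link** (input `hcross` of `exists_top_pair` with
`v = min r 1`): if moreover `g_r = dil(N₀)/dil(D₀)` (the last residue `f_r = N₀/D₀ ∈ F(x)` pushed by
`dilFrac`), then `z^{min r 1} · N_r · dil(D₀) = dil(N₀) · E_r` in `F[z,x]`.
[cite: DuttaDwivediSaxena2022, §3 proof of Thm. 3.2, Claim 3.7 (full version p0034 L904–913)] -/
theorem cross_of_link {r : ℕ} {N₀ D₀ : MvPolynomial (Fin n) F} (hD₀ : D₀ ≠ 0)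
    {Nr Er : MvPolynomial (Fin (n + 1)) F} {gr : FractionRing (MvPolynomial (Fin (n + 1)) F)}
    (hlink : gr * algebraMap _ _ Er = algebraMap _ _ ((X 0 : MvPolynomial (Fin (n + 1)) F) ^ min r 1 * Nr))
    (hgr : gr = dilFrac F n (algebraMap _ _ N₀ / algebraMap _ _ D₀)) :
    (X 0 : MvPolynomial (Fin (n + 1)) F) ^ min r 1 * Nr *
        bind₁ (fun i : Fin n => (X 0 * X i.succ : MvPolynomial (Fin (n + 1)) F)) D₀ =
      bind₁ (fun i : Fin n => (X 0 * X i.succ : MvPolynomial (Fin (n + 1)) F)) N₀ * Er := by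
  apply IsFractionRing.injective (MvPolynomial (Fin (n + 1)) F) (FractionRing (MvPolynomial (Fin (n + 1)) F))
  have hD : algebraMap (MvPolynomial (Fin (n + 1)) F) (FractionRing (MvPolynomial (Fin (n + 1)) F))
      (bind₁ (fun i : Fin n => (X 0 * X i.succ : MvPolynomial (Fin (n + 1)) F)) D₀) ≠ 0 := fun h =>
    hD₀ (dilate_injective ((IsFractionRing.injective _ _) (by rw [h, map_zero, map_zero])))
  rw [map_mul, ← hlink, hgr, map_div₀, dilFrac_algebraMap, dilFrac_algebraMap, map_mul]
  field_simp

end Link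

/-! ### (v3) The divisor quotient of the link, for the Claim 3.8 seam `hw0` -/

section LinkQuot

variable {F : Type*} [Field F] {n : ℕ}

/-- **The divisor quotient in the link**: under the hypotheses of `link_of_recursion`, for `j < r`
the Euler-chain quotient `g_j / (dil tn_j / dil td_j)` is the print-frame fraction
`(N_j·B_j)/(E_j·A_j)` — the object whose `z = 0` value is Claim 3.8's `w_j` (`hw0` of the
trace-back transcript). [cite: DuttaDwivediSaxena2022, §3 proof of Thm. 3.2, Claim 3.8 (full version p0035 L934–941)] -/
theorem quot_of_link {r : ℕ} (tn td : ℕ → MvPolynomial (Fin n) F) (a b : ℕ → ℕ)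
    (A B N E : ℕ → MvPolynomial (Fin (n + 1)) F)
    (g : ℕ → FractionRing (MvPolynomial (Fin (n + 1)) F))
    (htn : ∀ j < r, tn j ≠ 0) (htd : ∀ j < r, td j ≠ 0)
    (hA : ∀ j < r, (X 0 : MvPolynomial (Fin (n + 1)) F) ^ a j * A j =
      bind₁ (fun i : Fin n => (X 0 * X i.succ : MvPolynomial (Fin (n + 1)) F)) (tn j))
    (hB : ∀ j < r, (X 0 : MvPolynomial (Fin (n + 1)) F) ^ b j * B j =
      bind₁ (fun i : Fin n => (X 0 * X i.succ : MvPolynomial (Fin (n + 1)) F)) (td j))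
    (hab : ∀ j < r, a j = b j + min j 1)
    (hE0 : E 0 = 1)
    (hNs : ∀ j < r, N (j + 1) = pderiv 0 (N j * B j) * (E j * A j) - N j * B j * pderiv 0 (E j * A j))
    (hEs : ∀ j < r, E (j + 1) = (E j * A j) ^ 2)
    (hg0 : g 0 = algebraMap _ _ (N 0))
    (hgs : ∀ j < r, g (j + 1) = zDerivFrac F n (g j /
      (algebraMap _ _ (bind₁ (fun i : Fin n => (X 0 * X i.succ : MvPolynomial (Fin (n + 1)) F)) (tn j)) /
        algebraMap _ _ (bind₁ (fun i : Fin n => (X 0 * X i.succ : MvPolynomial (Fin (n + 1)) F)) (td j)))))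
    {j : ℕ} (hj : j < r) :
    g j / (algebraMap _ _ (bind₁ (fun i : Fin n => (X 0 * X i.succ : MvPolynomial (Fin (n + 1)) F)) (tn j)) /
        algebraMap _ _ (bind₁ (fun i : Fin n => (X 0 * X i.succ : MvPolynomial (Fin (n + 1)) F)) (td j))) =
      algebraMap _ (FractionRing (MvPolynomial (Fin (n + 1)) F)) (N j * B j) / algebraMap _ _ (E j * A j) ∧
      E j * A j ≠ 0 := by
  set ι := algebraMap (MvPolynomial (Fin (n + 1)) F) (FractionRing (MvPolynomial (Fin (n + 1)) F))
    with hι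
  have hιinj : Function.Injective ι := IsFractionRing.injective _ _
  have hz : ι (X 0) ≠ 0 := fun h => X_ne_zero (0 : Fin (n + 1)) (hιinj (by rw [h, map_zero]))
  have hdil0 : ∀ p : MvPolynomial (Fin n) F, p ≠ 0 →
      bind₁ (fun i : Fin n => (X 0 * X i.succ : MvPolynomial (Fin (n + 1)) F)) p ≠ 0 := fun p hp h =>
    hp (dilate_injective (by rw [h, map_zero]))
  obtain ⟨hEj, hgj⟩ := link_of_recursion tn td a b A B N E g htn htd hA hB hab hE0 hNs hEs hg0 hgs j hj.le
  have hAj : A j ≠ 0 := fun h => hdil0 _ (htn j hj) (by rw [← hA j hj, h, mul_zero])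
  have hBj : B j ≠ 0 := fun h => hdil0 _ (htd j hj) (by rw [← hB j hj, h, mul_zero])
  refine ⟨?_, mul_ne_zero hEj hAj⟩
  have hgj' : g j = ι ((X 0 : MvPolynomial (Fin (n + 1)) F) ^ min j 1 * N j) / ι (E j) := by
    rw [eq_div_iff (fun h => hEj (hιinj (by rw [h, map_zero]))), hgj]
  rw [hgj', ← hA j hj, ← hB j hj, hab j hj]
  have hEj' : ι (E j) ≠ 0 := fun h => hEj (hιinj (by rw [h, map_zero]))
  have hAj' : ι (A j) ≠ 0 := fun h => hAj (hιinj (by rw [h, map_zero]))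
  have hBj' : ι (B j) ≠ 0 := fun h => hBj (hιinj (by rw [h, map_zero]))
  simp only [map_mul, map_pow]
  field_simp
  ring

end LinkQuot

end DDS2021

end Literature.Computability.AlgebraicComplexity

end
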